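import Literature.Geometry.Lorentzian.ConformalCoordCurvatureSq
import Literature.Geometry.Lorentzian.ChartMetricCoord
import Literature.Geometry.Lorentzian.ConformalChange
import Literature.Geometry.Lorentzian.CurvatureNaturality
import Literature.Geometry.Lorentzian.IsometryProofs
import Literature.Geometry.Lorentzian.LeviCivitaProofs
import Literature.Geometry.Lorentzian.CurvatureRegularity
import Literature.Geometry.Lorentzian.RiemannianMeasureComparison
import HarnessLib

/-!
# Conformal changes `g' = ψ² g` in dimension four: the scalar curvature law
# `S(ψ² g) = ψ⁻³ (S(g) ψ − 6 □_g ψ)` on a manifold, the volume law `dV_{φh} = φ^{m/2} dV_h`,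
# and smoothness of the conformal factor

The four-dimensional companion of `ConformalChange.lean` (which transports the three-dimensional
law `S(φ⁴g) = φ⁻⁵(S(g)φ − 8□_gφ)` from charts to `3`-manifolds). Everything here is PROVED; the
file introduces no definition and no statement of `Prop` type. It supplies the two transformation
laws used by the Yamabe functional in dimension four (`Riemannian/YamabePositivity.lean`:
`Q(ψ²g) = (6∫|dψ|²_g + ∫R_gψ²)/(∫ψ⁴)^{1/2}`, Aubin 1982, Ch. 6, §6.3–6.4):

* `OpensChart.scalarCurvature_conformalRepr_sq_four` — for smooth metrics `g`, `g' = ψ² g` on an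
  open subset `U` of a `4`-dimensional model space `E` (abstract `scalarCurvature` and
  Laplace–Beltrami operator `dalembertian = tr_g Hess` of `LeviCivita.lean`):
  `S(g')(x) = ψ(x)⁻³ (S(g)(x) ψ(x) − 6 □_g ψ (x))` — the coordinate law
  `MetricCoord.IsMetricOn.scalAt_conformal_sq_four` of `ConformalCoordCurvatureSq.lean` (Besse 1987,
  Thm. 1.159 (f) with `e^{2f} = ψ²`, `n = 4`) read through the dictionary
  `scalarCurvature_eq_scalAt`, `dalembertian_eq_lapAt` of `ChartMetricCoord.lean`.
* `ChartInverseSelf.contMDiff_symm`, `.injective_mfderiv_symm`, `.contDiffAt_comp_symm` — the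
  inverse chart of a manifold modelled on its model vector space `E` is a smooth immersion from the
  chart target (the `E3`-versions are `ChartInverse.*` of `ConformalChange.lean`).
* `PseudoRiemannianMetric.scalarCurvature_conformal_sq_four` — **the law on a `4`-manifold**
  modelled on `E` (`dim E = 4`, charts into `E` itself, e.g. `𝓡 4`): for smooth metrics `g`, `g'`
  with their Levi-Civita connections and a smooth positive `ψ` with `g' = ψ² g` pointwise,
  `S(g') = ψ⁻³ (S(g) ψ − 6 □_g ψ)` at every point — Aubin 1982, Ch. 6, §6.3, eq. (1)
  (`4((n−1)/(n−2))Δφ + Rφ = R'φ^{(n+2)/(n−2)}`, `g' = φ^{4/(n−2)}g`, Aubin's `Δ = −∇^ν∇_ν`) at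
  `n = 4`; Lee–Parker 1987, (2.7). Proof word for word as `scalarCurvature_conformal_fourth_power`:
  pull back along the inverse chart (`scalarCurvature_comap`, `dalembertian_comap`,
  `CurvatureNaturality.lean` / `DalembertianNaturality.lean`) and apply the chart law.
* `sharp_comp_toBilinForm_of_conformal`, `det_sharp_comp_toBilinForm_of_conformal`,
  `riemannianMeasure_of_conformal` — **the Riemannian measure of a conformal metric**: for `C^n`
  Riemannian metrics `h₁ = φ h₂` on an `m`-manifold modelled on `ℝ^m`, `♯_{h₂} ∘ ♭_{h₁} = φ · id`,
  `det = φ^m`, hence `dV_{h₁} = √(φ^m) dV_{h₂}` (`riemannianMeasure_eq_withDensity_sqrt_det_endo`,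
  `RiemannianMeasureComparison.lean`; Aubin 1982, Ch. 6, §6.4: "`dV' = φ^N dV`").
* `MetricCoord.IsMetricOn.apply_riemAt_conformal` — **the covariant curvature tensor of a
  conformal metric** in coordinates, any dimension and signature (Besse 1987, Thm. 1.159 (b)):
  `G(R'(X,Y)Z,W) = G(R(X,Y)Z,W) − (B ⊙ G)(X,Y,Z,W)` for `G' = c·G`, with
  `B = H − θ⊗θ + ½|θ|²G` (`θ = dc/(2c)`, `H = ∇θ`) and the Kulkarni–Nomizu product in the slot
  convention of `WeylEnergy.lean`; from `riemAt_conformal_apply` (`ConformalCoordCurvature.lean`)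
  by metric compatibility, torsion-freeness and the symmetry of `Dθ`.
* `PseudoRiemannianMetric.contMDiff_conformalFactor_one` — a conformal factor `φ` between smooth
  metrics, `g' = φ g` with `g` Riemannian, is smooth (`φ = g'(s,s)/g(s,s)` for a local frame vector
  `s`; the `φ⁴`-version is `contMDiff_conformalFactor` of `ConformalFactorSmooth.lean`).

## References

* T. Aubin, *Nonlinear Analysis on Manifolds. Monge–Ampère Equations*, Grundlehren 252, Springer
  1982, Ch. 6, §6.3, eq. (1); §6.4 (`dV' = φ^N dV`). [Aubin1982]
* A. L. Besse, *Einstein Manifolds*, Springer 1987, Thm. 1.159 (f). [Besse1987]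
* J. M. Lee, T. H. Parker, *The Yamabe problem*, Bull. AMS 17 (1987) 37–91, (2.7). [LeeParker1987]
* B. O'Neill, *Semi-Riemannian geometry*, Academic Press 1983, Ch. 3, p. 60 (musical
  isomorphisms), pp. 90–91 (pullback metrics). [ONeill1983]
-/

noncomputable section

set_option maxSynthPendingDepth 3

open Bundle Set Function Filter Manifold MeasureTheory Module
open scoped Manifold ContDiff Topology

namespace Literature.Geometry.Lorentzian

open PseudoRiemannianMetric

/-! ### The Riemannian measure of a conformal metric: `dV_{φ h} = φ^{m/2} dV_h` -/

section ConformalVolume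

variable {H : Type*} [TopologicalSpace H] {n : ℕ∞ω} {m : ℕ}
  {I : ModelWithCorners ℝ (EuclideanSpace ℝ (Fin m)) H}
  {N : Type*} [TopologicalSpace N] [ChartedSpace H N] [IsManifold I ∞ N]
  (h₁ h₂ : ContMDiffRiemannianMetric I n (EuclideanSpace ℝ (Fin m)) (TangentSpace I : N → Type _))

/-- For conformal metrics `h₁ = φ h₂` the endomorphism `♯_{h₂} ∘ ♭_{h₁}` of `T_pN` is `φ(p) · id`.
[folklore] -/
theorem sharp_comp_toBilinForm_of_conformal {φ : N → ℝ}
    (hconf : ∀ (p : N) (v w : TangentSpace I p), h₁.inner p v w = φ p * h₂.inner p v w) (p : N) :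
    ((ofRiemannian h₂).sharp p).toLinearMap ∘ₗ (ofRiemannian h₁).toBilinForm p =
      φ p • LinearMap.id := by
  refine LinearMap.ext fun v ↦ ?_
  have hflat : (ofRiemannian h₁).toBilinForm p v = φ p • (ofRiemannian h₂).flat p v := by
    refine LinearMap.ext fun w ↦ ?_
    simp only [toBilinForm_apply, val_ofRiemannian, LinearMap.smul_apply, flat_apply, smul_eq_mul,
      hconf]
  simp only [LinearMap.coe_comp, LinearEquiv.coe_coe, Function.comp_apply, hflat, map_smul,
    sharp_flat, LinearMap.smul_apply, LinearMap.id_apply]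

/-- For conformal metrics `h₁ = φ h₂` on an `m`-manifold, `det (h₂⁻¹ h₁) = φ^m`. [folklore] -/
theorem det_sharp_comp_toBilinForm_of_conformal {φ : N → ℝ}
    (hconf : ∀ (p : N) (v w : TangentSpace I p), h₁.inner p v w = φ p * h₂.inner p v w) (p : N) :
    LinearMap.det (((ofRiemannian h₂).sharp p).toLinearMap ∘ₗ (ofRiemannian h₁).toBilinForm p) =
      φ p ^ m := by
  rw [sharp_comp_toBilinForm_of_conformal h₁ h₂ hconf p, LinearMap.det_smul, LinearMap.det_id,
    mul_one]
  congr 1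
  exact finrank_euclideanSpace_fin

variable [T3Space N] [MeasurableSpace N] [BorelSpace N] [SecondCountableTopology N]

/-- **The Riemannian measure of a conformal metric**: if `h₁ = φ h₂` pointwise on an `m`-manifold
modelled on `ℝ^m`, then `dV_{h₁} = √(φ^m) dV_{h₂} = φ^{m/2} dV_{h₂}` (Aubin 1982, Ch. 6, §6.4:
"`dV' = φ^N dV`" for `g' = φ^{4/(n-2)} g`, `N = 2n/(n-2)`; from `dV_{h₁} = √det(h₂⁻¹h₁) dV_{h₂}`,
`riemannianMeasure_eq_withDensity_sqrt_det_endo`, with `h₂⁻¹h₁ = φ · id`).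
[cite: Aubin1982, Ch. 6, §6.4] -/
theorem riemannianMeasure_of_conformal {φ : N → ℝ}
    (hconf : ∀ (p : N) (v w : TangentSpace I p), h₁.inner p v w = φ p * h₂.inner p v w) :
    riemannianMeasure h₁ =
      (riemannianMeasure h₂).withDensity fun p ↦ ENNReal.ofReal (Real.sqrt (φ p ^ m)) := by
  rw [riemannianMeasure_eq_withDensity_sqrt_det_endo h₁ h₂]
  congr 1
  funext p
  rw [det_sharp_comp_toBilinForm_of_conformal h₁ h₂ hconf p]

end ConformalVolume

/-! ### A conformal factor between smooth metrics is smooth -/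

namespace PseudoRiemannianMetric

variable {E : Type*} [NormedAddCommGroup E] [NormedSpace ℝ E] {H : Type*} [TopologicalSpace H]
  {I : ModelWithCorners ℝ E H} {M : Type*} [TopologicalSpace M] [ChartedSpace H M]
  [IsManifold I ∞ M]

/-- **A conformal factor between smooth metrics is smooth**: if `g` is Riemannian and
`g'(v, w) = φ(x) g(v, w)` for all `x, v, w`, then `φ ∈ C^∞(M)` (on a manifold of positive
dimension: `φ = g'(s,s)/g(s,s)` for a local frame vector `s`, a quotient of smooth functions,
`contMDiffOn_gram_localFrame`). The case `φ⁴` is `contMDiff_conformalFactor`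
(`ConformalFactorSmooth.lean`). [folklore] -/
theorem contMDiff_conformalFactor_one [Nontrivial E]
    (g g' : PseudoRiemannianMetric I ∞ E (TangentSpace I : M → Type _)) (hg : g.IsRiemannian)
    {φ : M → ℝ}
    (hconf : ∀ (x : M) (v w : TangentSpace I x), g'.val x v w = φ x * g.val x v w) :
    ContMDiff I 𝓘(ℝ, ℝ) ∞ φ := by
  classical
  intro x₀
  set bE : Module.Basis (Module.Basis.ofVectorSpaceIndex ℝ E) ℝ E := Module.Basis.ofVectorSpace ℝ E
    with hbE
  obtain ⟨i₀⟩ : Nonempty (Module.Basis.ofVectorSpaceIndex ℝ E) := bE.index_nonempty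
  set e := trivializationAt E (TangentSpace I : M → Type _) x₀ with he
  set s : (x : M) → TangentSpace I x := e.localFrame bE i₀ with hs
  have hx₀ : x₀ ∈ e.baseSet := by
    simp [he]
  have hG : CMDiff[e.baseSet] ∞ (fun x ↦ g.val x (s x) (s x)) := contMDiffOn_gram_localFrame e g bE i₀ i₀
  have hG' : CMDiff[e.baseSet] ∞ (fun x ↦ g'.val x (s x) (s x)) :=
    contMDiffOn_gram_localFrame e g' bE i₀ i₀
  have hspos : ∀ x ∈ e.baseSet, 0 < g.val x (s x) (s x) := by
    intro x hx
    refine hg x (s x) ?_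
    rw [hs, e.localFrame_apply_of_mem_baseSet bE hx]
    exact (e.basisAt bE hx).ne_zero i₀
  have hformula : ∀ x ∈ e.baseSet, φ x = g'.val x (s x) (s x) / g.val x (s x) (s x) := by
    intro x hx
    rw [hconf x (s x) (s x), mul_div_assoc, div_self (hspos x hx).ne', mul_one]
  have hnhds : e.baseSet ∈ 𝓝 x₀ := e.open_baseSet.mem_nhds hx₀
  have hq : ContMDiffAt I 𝓘(ℝ, ℝ) ∞ (fun x ↦ g'.val x (s x) (s x) / g.val x (s x) (s x)) x₀ :=
    ((hG' x₀ hx₀).contMDiffAt hnhds).div₀ ((hG x₀ hx₀).contMDiffAt hnhds) (hspos x₀ hx₀).ne'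
  refine hq.congr_of_eventuallyEq ?_
  filter_upwards [hnhds] with x hx
  exact hformula x hx

end PseudoRiemannianMetric

/-! ### The covariant curvature tensor of a conformal metric (Besse 1987, 1.159 (b)) -/

namespace MetricCoord

section RiemFour

variable {E : Type*} [NormedAddCommGroup E] [NormedSpace ℝ E] [FiniteDimensional ℝ E]
  [CompleteSpace E] {G : E → E →L[ℝ] E →L[ℝ] ℝ} {V : Set E} {x : E} {c : E → ℝ}

/-- **The covariant curvature tensor of a conformal metric** (Besse 1987, Thm. 1.159 (b)): with
`θ = dc/(2c)`, `T = θ♯`, `H = ∇θ` (`confHess`) and the symmetric form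
`B = H − θ ⊗ θ + ½ |θ|² G`, for constant fields
`G(R'(X,Y)Z, W) = G(R(X,Y)Z, W) − (B ⊙ G)(X,Y,Z,W)`, the Kulkarni–Nomizu product in the slot
convention of this tree (`(h ⊙ k)(a,b,c,d) = h_{ad}k_{bc} + h_{bc}k_{ad} − h_{ac}k_{bd} − h_{bd}k_{ac}`),
so that `Rm' = G'(R'·,·) = c (Rm − B ⊙ G)`. [cite: Besse1987, Thm. 1.159 (b)] -/
theorem IsMetricOn.apply_riemAt_conformal (hG : IsMetricOn G V) (hc : ContDiffOn ℝ ∞ c V)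
    (hc0 : ∀ y ∈ V, c y ≠ 0) (hx : x ∈ V) (X Y Z W : E) :
    G x (riemAt (fun y ↦ c y • G y) x X Y Z) W =
      G x (riemAt G x X Y Z) W
        - ((confHess G c x X W - confForm c x X * confForm c x W
              + 1 / 2 * confForm c x (confVec G c x) * G x X W) * G x Y Z
          + (confHess G c x Y Z - confForm c x Y * confForm c x Z
              + 1 / 2 * confForm c x (confVec G c x) * G x Y Z) * G x X W
          - (confHess G c x X Z - confForm c x X * confForm c x Z
              + 1 / 2 * confForm c x (confVec G c x) * G x X Z) * G x Y W
          - (confHess G c x Y W - confForm c x Y * confForm c x W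
              + 1 / 2 * confForm c x (confVec G c x) * G x Y W) * G x X Z) := by
  have hi := hG.isInvertible x hx
  have hs := hG.symm x hx
  -- the identities used
  have hsym : fderiv ℝ (confForm c) x Y X = fderiv ℝ (confForm c) x X Y :=
    hG.fderiv_confForm_comm hc hc0 hx Y X
  have hΓ : chrAt G x Y X = chrAt G x X Y := hG.chrAt_comm hx Y X
  have hP1 : fderiv ℝ G x X Y Z = G x (chrAt G x X Y) Z + G x Y (chrAt G x X Z) :=
    hG.fderiv_eq_chrAt hx X Y Z
  have hP2 : fderiv ℝ G x Y X Z = G x (chrAt G x Y X) Z + G x X (chrAt G x Y Z) :=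
    hG.fderiv_eq_chrAt hx Y X Z
  have hP3 : fderiv ℝ G x X (confVec G c x) W =
      G x (chrAt G x X (confVec G c x)) W + G x (confVec G c x) (chrAt G x X W) :=
    hG.fderiv_eq_chrAt hx X _ W
  have hP4 : fderiv ℝ G x Y (confVec G c x) W =
      G x (chrAt G x Y (confVec G c x)) W + G x (confVec G c x) (chrAt G x Y W) :=
    hG.fderiv_eq_chrAt hx Y _ W
  have hU1 : G x (fderiv ℝ (confVec G c) x X) W =
      fderiv ℝ (confForm c) x X W - fderiv ℝ G x X (confVec G c x) W :=
    hG.apply_fderiv_confVec hc hc0 hx X W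
  have hU2 : G x (fderiv ℝ (confVec G c) x Y) W =
      fderiv ℝ (confForm c) x Y W - fderiv ℝ G x Y (confVec G c x) W :=
    hG.apply_fderiv_confVec hc hc0 hx Y W
  have hT : ∀ w, G x (confVec G c x) w = confForm c x w := fun w ↦ apply_confVec hi w
  have hT' : ∀ w, G x w (confVec G c x) = confForm c x w := fun w ↦ apply_apply_confVec hi hs w
  have hs0 : G x Y X = G x X Y := hs _ _
  rw [hG.riemAt_conformal_apply hc hc0 hx X Y Z]
  simp only [confHess_apply, confDiff, map_add, map_sub, map_smul, smul_eq_mul, _root_.add_apply,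
    _root_.sub_apply, _root_.smul_apply, hT, hT', hΓ, hU1, hU2, hP1, hP2, hP3, hP4, hsym]
  linear_combination (confForm c x W * confForm c x Z) * hs0

end RiemFour

end MetricCoord

/-! ### The conformal transformation law of the scalar curvature in dimension four -/

namespace OpensChart

variable {E : Type*} [NormedAddCommGroup E] [NormedSpace ℝ E] [FiniteDimensional ℝ E]
  [CompleteSpace E] {U : TopologicalSpace.Opens E}
  {g g' : PseudoRiemannianMetric 𝓘(ℝ, E) ∞ E (TangentSpace 𝓘(ℝ, E) : U → Type _)}
  {G : E → E →L[ℝ] E →L[ℝ] ℝ} (hG : ∀ y : U, g.val y = G y) {ψ : E → ℝ}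
  (hG' : ∀ y : U, g'.val y = (ψ y ^ 2) • G y)

include hG hG' in
/-- **The law `S(ψ² g) = ψ⁻³ (S(g) ψ − 6 □_g ψ)` for metrics on an open subset of a
`4`-dimensional model space**, for the abstract scalar curvature and Laplace–Beltrami operator of
`LeviCivita.lean` (through the dictionary `scalarCurvature_eq_scalAt`, `dalembertian_eq_lapAt` of
`ChartMetricCoord.lean` and `MetricCoord.IsMetricOn.scalAt_conformal_sq_four`).
[cite: Aubin1982, Ch. 6, §6.3, eq. (1)] -/
theorem scalarCurvature_conformalRepr_sq_four [g.HasLeviCivita] [g'.HasLeviCivita]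
    (h4 : finrank ℝ E = 4) (hψ : ContDiffOn ℝ ∞ ψ (U : Set E))
    (hψ0 : ∀ y ∈ (U : Set E), ψ y ≠ 0) (x : U) :
    g'.scalarCurvature x =
      (ψ x ^ 3)⁻¹ * (g.scalarCurvature x * ψ x - 6 * g.dalembertian (fun y : U ↦ ψ y) x) := by
  have hmet : MetricCoord.IsMetricOn G (U : Set E) := isMetricOn_repr hG
  have hψx : ContDiffAt ℝ 2 ψ x :=
    (hψ.contDiffAt (U.2.mem_nhds x.2)).of_le (WithTop.coe_le_coe.mpr le_top)
  rw [scalarCurvature_eq_scalAt (G := fun y ↦ ψ y ^ 2 • G y) hG' x, scalarCurvature_eq_scalAt hG x,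
    dalembertian_eq_lapAt hG x (f := fun y : U ↦ ψ y) (Φ := ψ) (fun _ ↦ rfl) hψx]
  exact hmet.scalAt_conformal_sq_four hψ hψ0 x.2 h4

end OpensChart

/-! ### The inverse chart of a manifold modelled on its model vector space -/

namespace ChartInverseSelf

variable {E : Type*} [NormedAddCommGroup E] [NormedSpace ℝ E]
  {X : Type*} [TopologicalSpace X] [ChartedSpace E X] [IsManifold 𝓘(ℝ, E) ∞ X] (x : X)

/-- The inverse chart at `x`, as a map from the chart target (an open subset of `E`), is smooth
(`contMDiffOn_chart_symm`; the `E3` case is `ChartInverse.contMDiff_symm`). [folklore] -/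
theorem contMDiff_symm :
    ContMDiff 𝓘(ℝ, E) 𝓘(ℝ, E) (∞ + 1)
      (fun u : (⟨(chartAt E x).target, (chartAt E x).open_target⟩ : TopologicalSpace.Opens E) ↦
        (chartAt E x).symm u) := by
  have h : ((∞ : ℕ∞ω) + 1) = ∞ := rfl
  rw [h]
  exact (contMDiffOn_chart_symm (I := 𝓘(ℝ, E)) (x := x) (n := ∞)).comp_contMDiff
    contMDiff_subtype_val fun u ↦ u.2

/-- The inverse chart is an immersion: it has the smooth left inverse `chartAt E x`.
[folklore] -/
theorem injective_mfderiv_symm :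
    ∀ u : (⟨(chartAt E x).target, (chartAt E x).open_target⟩ : TopologicalSpace.Opens E),
      Function.Injective (mfderiv 𝓘(ℝ, E) 𝓘(ℝ, E)
        (fun u : (⟨(chartAt E x).target, (chartAt E x).open_target⟩ : TopologicalSpace.Opens E) ↦
          (chartAt E x).symm u) u) := by
  set U : TopologicalSpace.Opens E := ⟨(chartAt E x).target, (chartAt E x).open_target⟩ with hU
  set Φ : U → X := fun u ↦ (chartAt E x).symm u with hΦ
  set ψ : X → E := fun p ↦ chartAt E x p with hψ
  intro u
  have hmem : Φ u ∈ (chartAt E x).source := (chartAt E x).map_target u.2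
  have hΦd : MDifferentiableAt 𝓘(ℝ, E) 𝓘(ℝ, E) Φ u :=
    ((contMDiff_symm x).of_le le_self_add u).mdifferentiableAt (by simp)
  have hψd : MDifferentiableAt 𝓘(ℝ, E) 𝓘(ℝ, E) ψ (Φ u) :=
    (((contMDiffOn_chart (I := 𝓘(ℝ, E)) (x := x) (n := ∞)).contMDiffAt
      ((chartAt E x).open_source.mem_nhds hmem))).mdifferentiableAt (by simp)
  have hcomp : mfderiv 𝓘(ℝ, E) 𝓘(ℝ, E) (ψ ∘ Φ) u =
      (mfderiv 𝓘(ℝ, E) 𝓘(ℝ, E) ψ (Φ u)).comp (mfderiv 𝓘(ℝ, E) 𝓘(ℝ, E) Φ u) :=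
    mfderiv_comp u hψd hΦd
  have hid : ψ ∘ Φ = (Subtype.val : U → E) := by
    funext u'
    exact (chartAt E x).right_inv u'.2
  have hval : mfderiv 𝓘(ℝ, E) 𝓘(ℝ, E) (Subtype.val : U → E) u =
      ContinuousLinearMap.id ℝ E := by
    have := OpensChart.mfderiv_eq (U := U) (F := E) u Subtype.val id (fun _ ↦ rfl)
      differentiableAt_id
    rw [fderiv_id] at this
    exact this
  have hinj : Function.Injective
      ((mfderiv 𝓘(ℝ, E) 𝓘(ℝ, E) ψ (Φ u)).comp (mfderiv 𝓘(ℝ, E) 𝓘(ℝ, E) Φ u)) := by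
    rw [← hcomp, hid, hval]
    exact fun v w h ↦ h
  have hinj' : Function.Injective
      (⇑(mfderiv 𝓘(ℝ, E) 𝓘(ℝ, E) ψ (Φ u)) ∘ ⇑(mfderiv 𝓘(ℝ, E) 𝓘(ℝ, E) Φ u)) := hinj
  exact hinj'.of_comp

/-- A smooth function on `X` read through the inverse chart is smooth at the points of the chart
target. [folklore] -/
theorem contDiffAt_comp_symm {φ : X → ℝ} (hφ : ContMDiff 𝓘(ℝ, E) 𝓘(ℝ) ∞ φ) {u : E}
    (hu : u ∈ (chartAt E x).target) :
    ContDiffAt ℝ ∞ (fun y : E ↦ φ ((chartAt E x).symm y)) u := by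
  have hon : ContMDiffOn 𝓘(ℝ, E) 𝓘(ℝ) ∞ (φ ∘ (chartAt E x).symm) (chartAt E x).target :=
    hφ.comp_contMDiffOn (contMDiffOn_chart_symm (I := 𝓘(ℝ, E)) (x := x) (n := ∞))
  have hat : ContMDiffAt 𝓘(ℝ, E) 𝓘(ℝ) ∞ (φ ∘ (chartAt E x).symm) u :=
    hon.contMDiffAt ((chartAt E x).open_target.mem_nhds hu)
  exact contMDiffAt_iff_contDiffAt.1 hat

end ChartInverseSelf

namespace PseudoRiemannianMetric

/-- **The conformal transformation law of scalar curvature in dimension four.** Let `X` be a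
manifold modelled on a `4`-dimensional space `E` (charts into `E` itself), `g` and `g'` smooth
metrics on its tangent bundle with their Levi-Civita connections, and `ψ` a smooth positive
function with `g' = ψ² g` pointwise. Then at every point
`S(g')(x) = ψ(x)⁻³ (S(g)(x) ψ(x) − 6 □_g ψ (x))`, `□_g = tr_g Hess` the Laplace–Beltrami operator
— Aubin 1982, Ch. 6, §6.3, eq. (1) at `n = 4` (`6Δφ + Rφ = R'φ³`, `Δ = −∇^ν∇_ν`); Besse 1987,
Thm. 1.159 (f). Proof exactly as the three-dimensional `scalarCurvature_conformal_fourth_power`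
(`ConformalChange.lean`): pull both metrics back along the inverse chart at `x`
(`scalarCurvature_comap`, `dalembertian_comap`), where they differ by `(ψ ∘ Φ)²` and the law is
`OpensChart.scalarCurvature_conformalRepr_sq_four`. [cite: Aubin1982, Ch. 6, §6.3, eq. (1)] -/
theorem scalarCurvature_conformal_sq_four {E : Type*} [NormedAddCommGroup E] [NormedSpace ℝ E]
    [FiniteDimensional ℝ E] [CompleteSpace E] (h4 : finrank ℝ E = 4)
    {X : Type*} [TopologicalSpace X] [ChartedSpace E X] [IsManifold 𝓘(ℝ, E) ∞ X]
    (g g' : PseudoRiemannianMetric 𝓘(ℝ, E) ∞ E (TangentSpace 𝓘(ℝ, E) : X → Type _))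
    [g.HasLeviCivita] [g'.HasLeviCivita] {ψ : X → ℝ}
    (hψ : ContMDiff 𝓘(ℝ, E) 𝓘(ℝ) ∞ ψ) (hpos : ∀ x : X, 0 < ψ x)
    (hgg' : ∀ (x : X) (v w : TangentSpace 𝓘(ℝ, E) x), g'.val x v w = ψ x ^ 2 * g.val x v w)
    (x : X) :
    g'.scalarCurvature x =
      (ψ x ^ 3)⁻¹ * (g.scalarCurvature x * ψ x - 6 * g.dalembertian ψ x) := by
  -- the inverse chart at `x`
  set U : TopologicalSpace.Opens E := ⟨(chartAt E x).target, (chartAt E x).open_target⟩ with hU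
  set Φ : U → X := fun u ↦ (chartAt E x).symm u with hΦdef
  have hΦ : ContMDiff 𝓘(ℝ, E) 𝓘(ℝ, E) (∞ + 1) Φ := ChartInverseSelf.contMDiff_symm x
  have hΦ' : ∀ u, Function.Injective (mfderiv 𝓘(ℝ, E) 𝓘(ℝ, E) Φ u) :=
    ChartInverseSelf.injective_mfderiv_symm x
  have hdim : Module.finrank ℝ E = Module.finrank ℝ E := rfl
  have hpb : contMDiff_pullbackBilin 𝓘(ℝ, E) X 𝓘(ℝ, E) U ∞ := contMDiff_pullbackBilin_holds
  set u₀ : U := ⟨chartAt E x x, (chartAt E x).map_source (mem_chart_source E x)⟩ with hu₀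
  have hx : Φ u₀ = x := (chartAt E x).left_inv (mem_chart_source E x)
  -- the pulled-back metrics on `U`
  set gU := g.comap hpb Φ hΦ hΦ' hdim with hgU
  set gU' := g'.comap hpb Φ hΦ hΦ' hdim with hgU'
  haveI : gU.HasLeviCivita := gU.hasLeviCivita
  haveI : gU'.HasLeviCivita := gU'.hasLeviCivita
  -- naturality of `S` and `□`
  have hψ2 : ContMDiffAt 𝓘(ℝ, E) 𝓘(ℝ) 2 ψ (Φ u₀) := (hψ.of_le (WithTop.coe_le_coe.mpr le_top)) _
  rw [← hx, ← g'.scalarCurvature_comap hpb hΦ hΦ' hdim u₀, ← g.scalarCurvature_comap hpb hΦ hΦ' hdim u₀,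
    ← g.dalembertian_comap hpb hΦ hΦ' hdim hψ2]
  -- representatives on `E`
  set G : E → E →L[ℝ] E →L[ℝ] ℝ := Function.extend (Subtype.val : U → E)
    (fun y : U ↦ (gU.val y : E →L[ℝ] E →L[ℝ] ℝ)) (fun _ ↦ 0) with hGdef
  set ψE : E → ℝ := fun y ↦ ψ ((chartAt E x).symm y) with hψEdef
  have hG : ∀ y : U, gU.val y = G y := fun y ↦ by
    rw [hGdef, Subtype.val_injective.extend_apply]
  have hψy : ∀ y : U, ψE y = ψ (Φ y) := fun y ↦ rfl
  have hG' : ∀ y : U, gU'.val y = (ψE y ^ 2) • G y := by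
    intro y
    ext v w
    change g'.val (Φ y) (mfderiv 𝓘(ℝ, E) 𝓘(ℝ, E) Φ y v) (mfderiv 𝓘(ℝ, E) 𝓘(ℝ, E) Φ y w) =
      ψE y ^ 2 * G y v w
    rw [hgg', ← hG y]
    rfl
  -- the conformal factor in the chart
  have hψs : ContDiffOn ℝ ∞ ψE (U : Set E) := fun y hy ↦
    (ChartInverseSelf.contDiffAt_comp_symm x hψ hy).contDiffWithinAt
  have hψ0 : ∀ y ∈ (U : Set E), ψE y ≠ 0 := fun y _ ↦ (hpos _).ne'
  -- the chart computation
  have key := OpensChart.scalarCurvature_conformalRepr_sq_four hG (g' := gU') hG' h4 hψs hψ0 u₀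
  have hfun : (fun y : U ↦ ψE y) = ψ ∘ Φ := funext fun y ↦ hψy y
  rw [hfun, hψy] at key
  exact key

end PseudoRiemannianMetric

end Literature.Geometry.Lorentzian

end
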